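import Summits.ResolutionOfSingularities.ResolutionOfSingularities.Theorems.MarkedTransferCampaignW46MohWindowShadeFormalSeriesStatement
import Summits.ResolutionOfSingularities.ResolutionOfSingularities.Theorems.MarkedTransferCampaignW46MohWindowShadePolyWitness
import HarnessLib

/-!
# [OURS · L1 W4.6 rung (iii)] NON-VACUITY of the formal-series window regime: `((z^p + x^(p+1) + y^(p+1))·𝒪, p)` on `𝔸³_K` has an ISOLATED
# SURFACE SINGULARITY (Tjurina ideal `∋ x^p, y^p, z^p`) and inhabits `Regime.mohWindowSurfaceFormalSeries` over algebraically closed `K`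

Cell `res-hironaka`, LADDER-RESOLUTION rung L (D-0089), slot W4.6 rung (iii); seat res-L1-s46-pv-6 (gen 5). Host route MarkedTransfer,
`--supports stmt-ResolutionOfSingularities-16155 --as helper`; kind proof (no definition). Discharges the (VAC) disclosure of
`…MohWindowShadeFormalSeriesStatement.lean`.

WHAT.
* `isIsolatedHypersurface_fermat` — in `K⟦X₀, X₁, X₂⟧` (any field of characteristic `p`, three distinct indices `a, b, c`):
  `g = X_a^p + X_b^(p+1) + X_c^(p+1)` has `∂_b g = X_b^p`, `∂_c g = X_c^p` (`p + 1 = 1` in `K`), `X_a^p = g − X_b·X_b^p − X_c·X_c^p`, so the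
  Tjurina ideal contains `𝔪^(3p)` and the Tjurina algebra is finite over `K` (`BoubakriGreuelMarkwig.IsIsolatedHypersurface`).
* `formalSeriesAt_origin` / `regime_mohWindowSurfaceFormalSeries` / `exists_singular_state_mohWindowSurfaceFormalSeries` — over an algebraically
  closed field, gen 4's kernel witness state `E = ((z^p + x^(p+1) + y^(p+1))·𝒪, p)` on `𝔸³_K` (res-L1-s46-pv-3's `spaceAmbientDatum`, `…PolyWitness`
  p522062) lies in `Regime.mohWindowSurfaceFormalSeries` (adapted Cohen coordinates at the origin, `…FormalTerminates.exists_cohen_anchor_option`),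
  is standard and has non-empty singular locus: the series rung quantifies over an inhabited singular regime.

HONEST FRAMING. Nothing here is a statement of H. Hironaka's manuscript [Hironaka2017] and nothing asserts that any statement of it holds. AI-written;
AI review is weaker than expert review. No `sorry`; axioms standard. [folklore]
-/

noncomputable section

set_option linter.dupNamespace false -- mandated namespace of this single-conjunct summit

open CategoryTheory AlgebraicGeometry TopologicalSpace IsLocalRing

namespace Summit.ResolutionOfSingularities.ResolutionOfSingularities.Theorems

namespace CampaignW46

namespace MohWindowShadeFormalSeriesWitness

open Literature.AlgebraicGeometry.Resolution
open Literature.AlgebraicGeometry.Resolution.Hauser2010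
open Literature.AlgebraicGeometry.Resolution.BoubakriGreuelMarkwig
open Literature.AlgebraicGeometry.Hironaka2017.S02Preliminaries
open Literature.AlgebraicGeometry.Hironaka2017.Datum
open Literature.AlgebraicGeometry.Hironaka2017.SpecOrders
open Literature.AlgebraicGeometry.Hironaka2017
open Scheme.IdealSheafData
open Literature.RingTheory.MvPowerSeries.Jets (maximalIdeal_pow_eq_span_monomial finite_quotient_maximalIdeal_pow
  mem_maximalIdeal_iff_constantCoeff_eq_zero)
open SurfacePlane

/-! ## §1 The Tjurina ideal of the Fermat-type germ `X_a^p + X_b^(p+1) + X_c^(p+1)` -/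

section Tjurina

variable (p : ℕ) [hp : Fact p.Prime] (K : Type) [Field K] [CharP K p]

/-- `∂_i (X_j^n) = n · X_j^(n−1) · δ_{ij}` in `K⟦X⟧` (the tree's `MvPowerSeries.pderiv` is a derivation). [folklore] -/
theorem pderiv_X_pow (i j : Fin 3) (n : ℕ) :
    MvPowerSeries.pderiv i ((MvPowerSeries.X j : MvPowerSeries (Fin 3) K) ^ n) =
      (n : MvPowerSeries (Fin 3) K) * ((MvPowerSeries.X j : MvPowerSeries (Fin 3) K) ^ (n - 1) * (if j = i then 1 else 0)) := by
  classical
  rw [Derivation.leibniz_pow, MvPowerSeries.pderiv_X, smul_eq_mul, nsmul_eq_mul]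

omit hp in
/-- **`X_a^p, X_b^p, X_c^p` lie in the Tjurina ideal of `g = X_a^p + X_b^(p+1) + X_c^(p+1)`** (`∂_b g = X_b^p`, `∂_c g = X_c^p` since
`p + 1 = 1` and `p = 0` in `K`; `X_a^p = g − X_b X_b^p − X_c X_c^p`). [cite: BoubakriGreuelMarkwig2010, §1 (p. 3)] -/
theorem X_pow_mem_tjurinaIdeal {a b c : Fin 3} (hab : a ≠ b) (hac : a ≠ c) (hbc : b ≠ c) (i : Fin 3) (hi : i = a ∨ i = b ∨ i = c) :
    (MvPowerSeries.X i : MvPowerSeries (Fin 3) K) ^ p ∈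
      tjurinaIdeal ((MvPowerSeries.X a : MvPowerSeries (Fin 3) K) ^ p + MvPowerSeries.X b ^ (p + 1) + MvPowerSeries.X c ^ (p + 1)) := by
  classical
  set g : MvPowerSeries (Fin 3) K := MvPowerSeries.X a ^ p + MvPowerSeries.X b ^ (p + 1) + MvPowerSeries.X c ^ (p + 1) with hg
  haveI : CharP (MvPowerSeries (Fin 3) K) p := charP_of_injective_algebraMap (algebraMap K (MvPowerSeries (Fin 3) K)).injective p
  have hp0 : ((p : ℕ) : MvPowerSeries (Fin 3) K) = 0 := CharP.cast_eq_zero (MvPowerSeries (Fin 3) K) p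
  have hp1 : ((p + 1 : ℕ) : MvPowerSeries (Fin 3) K) = 1 := by rw [Nat.cast_succ, hp0, zero_add]
  -- the partial derivatives
  have hderiv : ∀ j : Fin 3, j ≠ a → (j = b ∨ j = c) →
      MvPowerSeries.pderiv j g = (MvPowerSeries.X j : MvPowerSeries (Fin 3) K) ^ p := by
    intro j hja hjbc
    rw [hg, map_add, map_add, pderiv_X_pow, pderiv_X_pow, pderiv_X_pow, if_neg (fun h => hja h.symm), hp1, hp0, Nat.add_sub_cancel]
    rcases hjbc with rfl | rfl
    · rw [if_pos rfl, if_neg (fun h => hbc h.symm)]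
      ring
    · rw [if_neg hbc, if_pos rfl]
      ring
  have hjac : ∀ j : Fin 3, j ≠ a → (j = b ∨ j = c) → (MvPowerSeries.X j : MvPowerSeries (Fin 3) K) ^ p ∈ tjurinaIdeal g := by
    intro j hja hjbc
    rw [← hderiv j hja hjbc]
    exact Ideal.mem_sup_right (Ideal.subset_span ⟨j, rfl⟩)
  have hb' : (MvPowerSeries.X b : MvPowerSeries (Fin 3) K) ^ p ∈ tjurinaIdeal g := hjac b (fun h => hab h.symm) (Or.inl rfl)
  have hc' : (MvPowerSeries.X c : MvPowerSeries (Fin 3) K) ^ p ∈ tjurinaIdeal g := hjac c (fun h => hac h.symm) (Or.inr rfl)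
  rcases hi with rfl | rfl | rfl
  · -- `X_a^p = g − X_b·X_b^p − X_c·X_c^p`
    have hga : (MvPowerSeries.X i : MvPowerSeries (Fin 3) K) ^ p =
        g - MvPowerSeries.X b * MvPowerSeries.X b ^ p - MvPowerSeries.X c * MvPowerSeries.X c ^ p := by
      rw [hg]; ring
    rw [hga]
    exact Ideal.sub_mem _ (Ideal.sub_mem _ (Ideal.mem_sup_left (Ideal.mem_span_singleton_self g)) (Ideal.mul_mem_left _ _ hb'))
      (Ideal.mul_mem_left _ _ hc')
  · exact hb'
  · exact hc'

/-- **`𝔪^(3p)` lies in the Tjurina ideal**: a monomial of degree `3p` in three variables has an exponent `≥ p`. [folklore] -/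
theorem maximalIdeal_pow_le_tjurinaIdeal {a b c : Fin 3} (hab : a ≠ b) (hac : a ≠ c) (hbc : b ≠ c) (hcover : ∀ i : Fin 3, i = a ∨ i = b ∨ i = c) :
    maximalIdeal (MvPowerSeries (Fin 3) K) ^ (3 * p) ≤
      tjurinaIdeal ((MvPowerSeries.X a : MvPowerSeries (Fin 3) K) ^ p + MvPowerSeries.X b ^ (p + 1) + MvPowerSeries.X c ^ (p + 1)) := by
  classical
  rw [maximalIdeal_pow_eq_span_monomial, Ideal.span_le]
  rintro _ ⟨e, he, rfl⟩
  change e.degree = 3 * p at he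
  -- some exponent is `≥ p`
  have hex : ∃ i : Fin 3, p ≤ e i := by
    by_contra hcon
    push Not at hcon
    have : e.degree ≤ 3 * (p - 1) := by
      rw [Finsupp.degree_apply]
      calc ∑ i ∈ e.support, e i ≤ ∑ i : Fin 3, e i := Finset.sum_le_sum_of_subset_of_nonneg (Finset.subset_univ _) (fun _ _ _ => Nat.zero_le _)
        _ ≤ ∑ _i : Fin 3, (p - 1) := Finset.sum_le_sum fun i _ => Nat.le_sub_one_of_lt (hcon i)
        _ = 3 * (p - 1) := by simp
    have hp1 := hp.out.one_lt
    omega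
  obtain ⟨i, hpi⟩ := hex
  -- `monomial e 1 = X_i^p · monomial (e − p·single i) 1`
  have hsplit : (MvPowerSeries.monomial e (1 : K) : MvPowerSeries (Fin 3) K) =
      MvPowerSeries.X i ^ p * MvPowerSeries.monomial (e - Finsupp.single i p) 1 := by
    rw [MvPowerSeries.X_pow_eq, MvPowerSeries.monomial_mul_monomial, one_mul,
      add_tsub_cancel_of_le (Finsupp.single_le_iff.mpr hpi)]
  show MvPowerSeries.monomial e (1 : K) ∈ _
  rw [hsplit]
  exact Ideal.mul_mem_right _ _ (X_pow_mem_tjurinaIdeal p K hab hac hbc i (hcover i))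

/-- **The Fermat-type germ is an isolated hypersurface singularity** (finite Tjurina algebra). [cite: BoubakriGreuelMarkwig2010, §1 (p. 3)] -/
theorem isIsolatedHypersurface_fermat {a b c : Fin 3} (hab : a ≠ b) (hac : a ≠ c) (hbc : b ≠ c) (hcover : ∀ i : Fin 3, i = a ∨ i = b ∨ i = c) :
    IsIsolatedHypersurface ((MvPowerSeries.X a : MvPowerSeries (Fin 3) K) ^ p + MvPowerSeries.X b ^ (p + 1) + MvPowerSeries.X c ^ (p + 1)) := by
  have h := maximalIdeal_pow_le_tjurinaIdeal p K hab hac hbc hcover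
  haveI := finite_quotient_maximalIdeal_pow (σ := Fin 3) (K := K) (3 * p)
  exact Module.Finite.of_surjective (Ideal.Quotient.factorₐ K h).toLinearMap (Ideal.Quotient.factor_surjective h)

/-- The renamed germ of the formal presentation `z^p + (y₀^(p+1) + y₁^(p+1))(u)` IS the Fermat-type germ, hence isolated. [folklore] -/
theorem isIsolatedHypersurface_presentation :
    IsIsolatedHypersurface (MvPowerSeries.renameEquiv K MohWindowShadeFormalSeries.optionFinTwoEquiv
      ((MvPowerSeries.X none : MvPowerSeries (Option (Fin 2)) K) ^ p +
        MvPowerSeries.rename (some : Fin 2 → Option (Fin 2))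
          (((MvPolynomial.X 0 ^ (p + 1) + MvPolynomial.X 1 ^ (p + 1) : MvPolynomial (Fin 2) K)) : MvPowerSeries (Fin 2) K))) := by
  set ε := MohWindowShadeFormalSeries.optionFinTwoEquiv with hε
  have hren : MvPowerSeries.renameEquiv K ε
      ((MvPowerSeries.X none : MvPowerSeries (Option (Fin 2)) K) ^ p +
        MvPowerSeries.rename (some : Fin 2 → Option (Fin 2))
          (((MvPolynomial.X 0 ^ (p + 1) + MvPolynomial.X 1 ^ (p + 1) : MvPolynomial (Fin 2) K)) : MvPowerSeries (Fin 2) K)) =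
      (MvPowerSeries.X (ε none) : MvPowerSeries (Fin 3) K) ^ p + MvPowerSeries.X (ε (some 0)) ^ (p + 1) +
        MvPowerSeries.X (ε (some 1)) ^ (p + 1) := by
    change MvPowerSeries.rename ε ((MvPowerSeries.X none : MvPowerSeries (Option (Fin 2)) K) ^ p +
        MvPowerSeries.rename (some : Fin 2 → Option (Fin 2))
          (((MvPolynomial.X 0 ^ (p + 1) + MvPolynomial.X 1 ^ (p + 1) : MvPolynomial (Fin 2) K)) : MvPowerSeries (Fin 2) K)) = _
    simp only [MvPolynomial.coe_add, MvPolynomial.coe_pow, MvPolynomial.coe_X, map_add, map_pow, MvPowerSeries.rename_X]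
    ring
  rw [hren]
  have hinj := ε.injective
  refine isIsolatedHypersurface_fermat p K (fun h => Option.some_ne_none 0 (hinj h).symm) (fun h => Option.some_ne_none 1 (hinj h).symm)
    (fun h => ?_) fun i => ?_
  · exact absurd (Option.some_injective _ (hinj h)) (by decide)
  · obtain ⟨o, rfl⟩ := ε.surjective i
    rcases o with _ | l
    · exact Or.inl rfl
    · have : l = 0 ∨ l = 1 := by fin_cases l <;> simp
      rcases this with rfl | rfl
      · exact Or.inr (Or.inl rfl)
      · exact Or.inr (Or.inr rfl)

end Tjurina

/-! ## §2 The witness state on `𝔸³_K` (algebraically closed `K`) -/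

section Witness

variable (p : ℕ) [hp : Fact p.Prime] (K : Type) [Field K] [CharP K p]

omit hp [CharP K p] in
/-- The order of a coerced polynomial: below `ord₀` every coefficient vanishes, at `ord₀` one survives. [folklore] -/
theorem order_coe_bounds {F : MvPolynomial (Fin 2) K} {a b : ℕ} (ha : (a : ℕ∞) < ordZero F) (hb : ordZero F < (b : ℕ)) :
    (a : ℕ∞) < (F : MvPowerSeries (Fin 2) K).order ∧ (F : MvPowerSeries (Fin 2) K).order < (b : ℕ) := by
  classical
  constructor
  · have h1 : ((a + 1 : ℕ) : ℕ∞) ≤ (F : MvPowerSeries (Fin 2) K).order := by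
      refine MvPowerSeries.nat_le_order fun d hd => ?_
      rw [MvPolynomial.coeff_coe]
      by_contra hne
      have hmem : d ∈ F.support := MvPolynomial.mem_support_iff.mpr hne
      have hle := (Literature.Barriers.ResolutionOfSingularities.HauserPerlega.natCast_le_ordZero_iff F (a + 1)).mp
        (Order.add_one_le_of_lt ha) d hmem
      omega
    exact lt_of_lt_of_le (by exact_mod_cast Nat.lt_succ_self a) h1
  · have hF0 : F ≠ 0 := by
      rintro rfl
      rw [ordZero_zero] at hb
      exact absurd hb (not_lt.mpr le_top)
    obtain ⟨ν, hν⟩ : ∃ ν : ℕ, ordZero F = ν :=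
      ⟨_, (ENat.coe_toNat (Literature.Barriers.ResolutionOfSingularities.HauserPerlega.ordZero_ne_top hF0)).symm⟩
    obtain ⟨⟨d, hd, hdeg⟩, -⟩ := (ordZero_eq_nat_iff F ν).mp hν
    have h1 : (F : MvPowerSeries (Fin 2) K).order ≤ d.degree :=
      MvPowerSeries.order_le (by rw [MvPolynomial.coeff_coe]; exact hd)
    rw [hdeg] at h1
    rw [hν] at hb
    exact lt_of_le_of_lt h1 hb

/-- **The formal-series presentation at the origin of `𝔸³_K`** (algebraically closed `K`): at every singular point of
`E = ((z^p + x^(p+1) + y^(p+1))·𝒪, p)` the stalk ideal has a formal presentation `z^p + (u₀^(p+1) + u₁^(p+1))` with isolated surface singularity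
(adapted Cohen coordinates through the constants, `…FormalTerminates.exists_cohen_anchor_option`). [cite: Matsumura1987, Thm. 29.7] -/
theorem regime_mohWindowSurfaceFormalSeries [IsAlgClosed K] :
    Regime.mohWindowSurfaceFormalSeries (p := p) (K := K) (spaceAmbientDatum K p)
      ⟨shf (R3 K) (Ideal.span {MvPolynomial.X 2 ^ p + MvPolynomial.X 0 ^ (p + 1) + MvPolynomial.X 1 ^ (p + 1)}), p⟩ := by
  classical
  have hp2 : 2 ≤ p := hp.out.two_le
  have hpd : p < p + 1 := Nat.lt_succ_self p
  have hd2 : p + 1 < 2 * p := by omega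
  have hd := not_dvd_of_window p hpd hd2
  have hRg := regime_mohWindowSurfaceInsep p K hpd hd2
  refine ⟨hRg, fun ξ hξ => ?_⟩
  have hx : ξ.asIdeal = originIdeal K 3 := (mem_sing_iff p K hpd hd ξ).mp hξ
  obtain ⟨hR, h3, hcl, -, -⟩ := MohWindowShadeAnchorWalk.regime_point hRg hξ
  haveI := hR
  have hxyz := (maximalIdeal_stalk_origin K hx).symm
  obtain ⟨e, hEx, hEy, hEz, hEC⟩ := exists_cohen_anchor_option h3 hxyz (germConst (spaceAmbientDatum K p) ξ)
    (MohWindowShadeAnchorWalk.exists_sub_germ_sectionConst_mem (spaceAmbientDatum K p) hcl)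
  have hord := order_coe_bounds K (F := (MvPolynomial.X 0 ^ (p + 1) + MvPolynomial.X 1 ^ (p + 1) : MvPolynomial (Fin 2) K))
    (a := p) (b := 2 * p) (by rw [MohWindowShadePolyWitness.ordZero_binom K (by omega)]; exact_mod_cast hpd)
    (by rw [MohWindowShadePolyWitness.ordZero_binom K (by omega)]; exact_mod_cast hd2)
  refine ⟨e, _, 1, (MvPolynomial.X 0 ^ (p + 1) + MvPolynomial.X 1 ^ (p + 1) : MvPolynomial (Fin 2) K), fun d hP => ?_, hord.1, hord.2,
    stalkIdeal_eq_span p K (p + 1) ξ, isUnit_one, ?_, isIsolatedHypersurface_presentation p K⟩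
  · -- no `p`-th power monomials: `x^d + y^d` is cleaned (`p ∤ d`)
    rw [MvPolynomial.coeff_coe, ← MohWindowShadePolyWitness.deletePthPowers_binom p K hd, coeff_deletePthPowers, if_pos hP]
  · -- read the generator through `φ = e ∘ (𝒪 → 𝒪̂)` (a ring map on the stalk type of the ambient datum)
    set φ : (spaceAmbientDatum K p).Z.presheaf.stalk ξ →+* MvPowerSeries (Option (Fin 2)) K :=
      (e : _ →+* MvPowerSeries (Option (Fin 2)) K).comp
        (algebraMap ((spaceAmbientDatum K p).Z.presheaf.stalk ξ)
          (AdicCompletion (maximalIdeal ((spaceAmbientDatum K p).Z.presheaf.stalk ξ)) ((spaceAmbientDatum K p).Z.presheaf.stalk ξ))) with hφ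
    have hφa : ∀ r, φ r = e (algebraMap _ _ r) := fun r => rfl
    have hx' : φ (algebraMap (R3 K) (St (R3 K) ξ) (MvPolynomial.X 0)) = MvPowerSeries.X (some 0) := by rw [hφa]; exact hEx
    have hy' : φ (algebraMap (R3 K) (St (R3 K) ξ) (MvPolynomial.X 1)) = MvPowerSeries.X (some 1) := by rw [hφa]; exact hEy
    have hz' : φ (algebraMap (R3 K) (St (R3 K) ξ) (MvPolynomial.X 2)) = MvPowerSeries.X none := by rw [hφa]; exact hEz
    rw [one_mul, ← hφa]
    erw [map_add, map_add, map_pow, map_pow, map_pow, hx', hy', hz']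
    simp only [MvPolynomial.coe_add, MvPolynomial.coe_pow, MvPolynomial.coe_X, map_add, map_pow, MvPowerSeries.rename_X]

/-- **[OURS · W4.6 rung (iii)-NV] for EVERY prime `p` and EVERY algebraically closed field `K` of characteristic `p` the formal-series window
regime contains a STANDARD state with NON-EMPTY singular locus** (`((z^p + x^(p+1) + y^(p+1))·𝒪, p)` on `𝔸³_K`). NOT a statement of the
manuscript. [folklore] -/
theorem exists_singular_state_mohWindowSurfaceFormalSeries [IsAlgClosed K] :
    ∃ (A : AmbientDatum p K) (E : IdealExponent A.Z),
      Regime.mohWindowSurfaceFormalSeries (p := p) (K := K) A E ∧ E.IsStandard ∧ E.sing.Nonempty := by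
  have hp2 : 2 ≤ p := hp.out.two_le
  exact ⟨spaceAmbientDatum K p, _, regime_mohWindowSurfaceFormalSeries p K, isStandard p K (Nat.lt_succ_self p),
    sing_nonempty p K (Nat.lt_succ_self p) (not_dvd_of_window p (Nat.lt_succ_self p) (by omega))⟩

end Witness

end MohWindowShadeFormalSeriesWitness

end CampaignW46

end Summit.ResolutionOfSingularities.ResolutionOfSingularities.Theorems

end
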